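import Summits.BirchSwinnertonDyer.Rank1Residual.Additive.X3BranchLineCharacterQuadratic
import HarnessLib

/-!
# X3 certificate road at `p = 3`: the per-pair line certificate WITH ITS CHARACTERS for a prime kernel
# discriminant `q ≡ 3 (mod 4)` (kernel field `ℚ(√q)`, character `χ₄·(·/q)` modulo `4q`, quotient
# character `ψ = ω₃·φ⁻¹` of level `12q`) — cell `bsd-eis`, seat `bsd-eis-x3` gen 5; THEOREMS ONLY

HONEST FRAMING (FULL-BSD rank-`≤ 1` programme D-0033, `run/shared/lean/pub/bsd-eis/README.md` §4;
excluded-domain X3 = additive reducible, row B2 `r = 0`, (M), NON-degenerate). A TOOL: the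
`q ≡ 3 (mod 4)` analogue of `exists_lineDatum_three_characters_of_cert_prime` (`q ≡ 1 (mod 4)`, gen 3)
for the generated per-pair displays; `98` of the `1 094` (M) non-degenerate parity-OK rank-`0` classes
at `p = 3` have such a kernel discriminant (`q ∈ {7, 11, 19, 23, 31, 43, 47}`). For `q ≡ 3 (mod 4)`
the Gauss sum squares to `q* = −q`, so `√q = ζ₄·√q*` is a radical for the character `χ₄·(·/q)` of
conductor `4q` (`Rat.smul_mul_eq_changeLevel_mul`).

* `legendreChi4Character_three_isPrimitive` — `φ = χ₄·(·/q)` read in `𝔽₃` is primitive of conductor `4q`;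
* `legendreChi4Character_three_apply_natCast` — its VALUE TABLE on `ℕ` (for `decide`);
* `exists_lineDatum_three_characters_of_cert_prime_three_mod_four` — the packaging.

References: [GreenbergVatsal2000] §2 p. 28; [Washington1997] Ch. 3; [IrelandRosen1990] Ch. 6 Prop. 6.3.2.
-/

set_option autoImplicit false

noncomputable section

open scoped Classical NumberField

namespace Summit.BirchSwinnertonDyer.Rank1Residual.Additive

open WeierstrassCurve Polynomial NumberField IsDedekindDomain Field
  Literature.NumberTheory.GaloisRepresentations
  Literature.NumberTheory.EllipticCurves
  Literature.NumberTheory.EllipticCurves.Rank1Residual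
  Summit.BirchSwinnertonDyer.Rank1Residual.GaloisImage.RamifiedOrdinaryLineTwist

/-- Characters with coprime conductors: `f(χψ) = f(χ)·f(ψ)` (the tree's `RouteUPsiD11` §1 /
`X3BranchQuotCharacter` §1 argument). [cite: Washington1997, Ch. 3 (conductor of a product of characters of coprime conductor)] -/
private theorem conductor_mul_eq_mul_of_coprime'' {R : Type*} [CommRing R] [IsDomain R] {n : ℕ}
    [NeZero n] (χ ψ : DirichletCharacter R n) (h : χ.conductor.Coprime ψ.conductor) :
    (χ * ψ).conductor = χ.conductor * ψ.conductor := by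
  apply Nat.dvd_antisymm
  · have := DirichletCharacter.conductor_mul_dvd_lcm_conductor χ ψ
    rwa [h.lcm_eq_mul] at this
  · have hχ : χ.conductor ∣ (χ * ψ).conductor := by
      have h1 : χ = (χ * ψ) * ψ⁻¹ := by rw [mul_assoc, mul_inv_cancel, mul_one]
      have h2 := DirichletCharacter.conductor_mul_dvd_lcm_conductor (χ * ψ) ψ⁻¹
      rw [← h1, DirichletCharacter.conductor_inv] at h2
      exact h.dvd_of_dvd_mul_right (h2.trans (Nat.lcm_dvd_mul _ _))
    have hψ : ψ.conductor ∣ (χ * ψ).conductor := by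
      have h1 : ψ = (χ * ψ) * χ⁻¹ := by rw [mul_comm χ ψ, mul_assoc, mul_inv_cancel, mul_one]
      have h2 := DirichletCharacter.conductor_mul_dvd_lcm_conductor (χ * ψ) χ⁻¹
      rw [← h1, DirichletCharacter.conductor_inv] at h2
      exact h.symm.dvd_of_dvd_mul_right (h2.trans (Nat.lcm_dvd_mul _ _))
    exact h.mul_dvd_of_dvd_of_dvd hχ hψ

variable {q : ℕ} [hq : Fact q.Prime]

/-- **`φ = χ₄·(·/q)` read in `𝔽₃` is PRIMITIVE of conductor `4q`** (`q` an odd prime): the conductors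
`4` (`chi4_three_isPrimitive`) and `q` (`X3Branch.legendreCharacter_isPrimitive`) are coprime.
[cite: Washington1997, Ch. 3 (conductors of Dirichlet characters)] -/
theorem legendreChi4Character_three_isPrimitive (hq2 : q ≠ 2) :
    DirichletCharacter.IsPrimitive
      ((DirichletCharacter.changeLevel (dvd_mul_right 4 q) ZMod.χ₄ * DirichletCharacter.changeLevel (dvd_mul_left q 4) (quadraticChar (ZMod q)) :
          MulChar (ZMod (4 * q)) ℤ).ringHomComp (Int.castRingHom (ZMod 3)) :
        DirichletCharacter (ZMod 3) (4 * q)) := by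
  haveI : NeZero (4 * q) := ⟨mul_ne_zero (by norm_num) hq.out.ne_zero⟩
  have h4 : DirichletCharacter.conductor
      (ZMod.χ₄.ringHomComp (Int.castRingHom (ZMod 3)) : DirichletCharacter (ZMod 3) 4) = 4 :=
    chi4_three_isPrimitive
  have hL : DirichletCharacter.conductor
      ((quadraticChar (ZMod q)).ringHomComp (Int.castRingHom (ZMod 3)) : DirichletCharacter (ZMod 3) q) = q :=
    X3Branch.legendreCharacter_isPrimitive (p := 3) (q := q) (by decide) hq2
  have hcop : (DirichletCharacter.conductor (DirichletCharacter.changeLevel (dvd_mul_right 4 q)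
        (ZMod.χ₄.ringHomComp (Int.castRingHom (ZMod 3)) : DirichletCharacter (ZMod 3) 4))).Coprime
      (DirichletCharacter.conductor (DirichletCharacter.changeLevel (dvd_mul_left q 4)
        ((quadraticChar (ZMod q)).ringHomComp (Int.castRingHom (ZMod 3)) : DirichletCharacter (ZMod 3) q))) := by
    rw [DirichletCharacter.conductor_changeLevel, DirichletCharacter.conductor_changeLevel, h4, hL]
    have : Nat.Coprime 4 q := by
      rw [show (4 : ℕ) = 2 ^ 2 by norm_num]
      exact Nat.Coprime.pow_left 2 ((Nat.coprime_primes Nat.prime_two hq.out).mpr (Ne.symm hq2))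
    exact this
  rw [MulChar.ringHomComp_mul, DirichletCharacter.ringHomComp_changeLevel,
    DirichletCharacter.ringHomComp_changeLevel, DirichletCharacter.isPrimitive_def,
    conductor_mul_eq_mul_of_coprime'' _ _ hcop, DirichletCharacter.conductor_changeLevel, DirichletCharacter.conductor_changeLevel, h4, hL]

/-- **VALUE TABLE of `φ = χ₄·(·/q)` read in `𝔽₃`** on natural numbers: `φ(a) = χ₄(a)·(a/q)` (cast to
`𝔽₃`) for `a` coprime to `4q`, else `0` — the decidable form consumed by the display kit III.
[cite: Washington1997, Ch. 3 (Dirichlet characters)] -/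
theorem legendreChi4Character_three_apply_natCast (a : ℕ) :
    ((DirichletCharacter.changeLevel (dvd_mul_right 4 q) ZMod.χ₄ * DirichletCharacter.changeLevel (dvd_mul_left q 4) (quadraticChar (ZMod q)) :
          MulChar (ZMod (4 * q)) ℤ).ringHomComp (Int.castRingHom (ZMod 3)) :
        DirichletCharacter (ZMod 3) (4 * q)) (a : ZMod (4 * q)) =
      if a.Coprime (4 * q) then
        ((ZMod.χ₄ (a : ZMod 4) : ℤ) : ZMod 3) * ((quadraticChar (ZMod q) (a : ZMod q) : ℤ) : ZMod 3)
      else 0 := by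
  haveI : NeZero (4 * q) := ⟨mul_ne_zero (by norm_num) hq.out.ne_zero⟩
  by_cases hc : a.Coprime (4 * q)
  · rw [if_pos hc]
    have hu : IsUnit (a : ZMod (4 * q)) := (ZMod.isUnit_iff_coprime a (4 * q)).mpr hc
    obtain ⟨u, hu'⟩ := hu
    rw [← hu', MulChar.ringHomComp_apply, MulChar.mul_apply, DirichletCharacter.changeLevel_eq_cast_of_dvd _ (dvd_mul_right 4 q),
      DirichletCharacter.changeLevel_eq_cast_of_dvd _ (dvd_mul_left q 4), hu', ZMod.cast_natCast (dvd_mul_right 4 q),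
      ZMod.cast_natCast (dvd_mul_left q 4), map_mul, eq_intCast, eq_intCast]
  · rw [if_neg hc]
    exact MulChar.map_nonunit _ (fun h ↦ hc ((ZMod.isUnit_iff_coprime a (4 * q)).mp h))

variable {W : WeierstrassCurve ℚ} [W.IsElliptic]

/-- **The line datum WITH ITS TWO CHARACTERS for a prime kernel discriminant `q ≡ 3 (mod 4)`, `q ≠ 3`.**
From the certificate `(x₀, s, q)` (`Ψ₃(x₀) = 0`, `s ≠ 0`, `q·s² = Ψ₂Sq(x₀)`): the rational `3`-line `Φ₀`
(even, non-trivial action, `χ_K`-twist ramified at `3`) on which `Γ_ℚ` acts through the PRIMITIVE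
character `φ = χ₄·(·/q)` read in `𝔽₃` (radical `√q = ζ₄·√q*`, `q* = −q`), with the PRIMITIVE quotient
character `ψ = ω₃·φ⁻¹` of level `3·(4q)` on `W[3]/Φ₀` (`exists_lineDatum_three_characters_of_cert_quadratic`).
[folklore] -/
theorem exists_lineDatum_three_characters_of_cert_prime_three_mod_four [hp : Fact (Nat.Prime 3)]
    {x₀ s : ℚ} (hq4 : q % 4 = 3) (hq3 : q ≠ 3)
    (hψ : W.Ψ₃.eval x₀ = 0) (hs : s ≠ 0) (hDs : ((q : ℤ) : ℚ) * s ^ 2 = W.Ψ₂Sq.eval x₀) :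
    ∃ Φ₀ : AddSubgroup (geomTorsion W ((3 : ℕ) : ℤ)), IsRationalLine W 3 Φ₀ ∧ LineEven W 3 Φ₀ ∧
      (∃ (σ : absoluteGaloisGroup ℚ) (P : W.geomTorsion ((3 : ℕ) : ℤ)), P ∈ Φ₀ ∧ σ • P ≠ P) ∧
      (∀ (K : Type) [Field K] [NumberField K] [(galRange (K := ℚ) K).Normal],
        Module.finrank ℚ K = 2 →
        (∃ θ : K, θ ^ 2 = algebraMap ℚ K ((-1) ^ ((3 : ℕ) / 2) * (3 : ℕ))) →
        ¬ ∀ v : HeightOneSpectrum (𝓞 ℚ), (((3 : ℕ) : ℕ) : 𝓞 ℚ) ∈ v.asIdeal →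
          ∀ 𝔓 ∈ v.primesAbove, ∀ σ ∈ 𝔓.inertia (absoluteGaloisGroup ℚ), ∀ P ∈ Φ₀,
            σ • P = (if σ ∈ galRange (K := ℚ) K then P else -P)) ∧
      DirichletCharacter.IsPrimitive
        ((DirichletCharacter.changeLevel (dvd_mul_right 4 q) ZMod.χ₄ * DirichletCharacter.changeLevel (dvd_mul_left q 4) (quadraticChar (ZMod q)) :
            MulChar (ZMod (4 * q)) ℤ).ringHomComp (Int.castRingHom (ZMod 3)) :
          DirichletCharacter (ZMod 3) (4 * q)) ∧
      (∀ (σ : absoluteGaloisGroup ℚ), ∀ P ∈ Φ₀,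
        σ • P = (((DirichletCharacter.changeLevel (dvd_mul_right 4 q) ZMod.χ₄ *
            DirichletCharacter.changeLevel (dvd_mul_left q 4) (quadraticChar (ZMod q)) : MulChar (ZMod (4 * q)) ℤ).ringHomComp
            (Int.castRingHom (ZMod 3)) : DirichletCharacter (ZMod 3) (4 * q))
          ((modNCyclotomicCharacter ℚ (4 * q) σ : (ZMod (4 * q))ˣ) : ZMod (4 * q))).val • P) ∧
      DirichletCharacter.IsPrimitive
        (DirichletCharacter.changeLevel (dvd_mul_right 3 (4 * q)) (MulChar.ofUnitHom (MonoidHom.id (ZMod 3)ˣ)) *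
          DirichletCharacter.changeLevel (dvd_mul_left (4 * q) 3)
            ((DirichletCharacter.changeLevel (dvd_mul_right 4 q) ZMod.χ₄ *
              DirichletCharacter.changeLevel (dvd_mul_left q 4) (quadraticChar (ZMod q)) : MulChar (ZMod (4 * q)) ℤ).ringHomComp
              (Int.castRingHom (ZMod 3)) : DirichletCharacter (ZMod 3) (4 * q))⁻¹ :
          DirichletCharacter (ZMod 3) (3 * (4 * q))) ∧
      (∀ (σ : absoluteGaloisGroup ℚ) (P : W.geomTorsion ((3 : ℕ) : ℤ)),
        σ • P - ((DirichletCharacter.changeLevel (dvd_mul_right 3 (4 * q)) (MulChar.ofUnitHom (MonoidHom.id (ZMod 3)ˣ)) *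
          DirichletCharacter.changeLevel (dvd_mul_left (4 * q) 3)
            ((DirichletCharacter.changeLevel (dvd_mul_right 4 q) ZMod.χ₄ *
              DirichletCharacter.changeLevel (dvd_mul_left q 4) (quadraticChar (ZMod q)) : MulChar (ZMod (4 * q)) ℤ).ringHomComp
              (Int.castRingHom (ZMod 3)) : DirichletCharacter (ZMod 3) (4 * q))⁻¹ :
          DirichletCharacter (ZMod 3) (3 * (4 * q)))
          ((modNCyclotomicCharacter ℚ (3 * (4 * q)) σ : (ZMod (3 * (4 * q)))ˣ) : ZMod (3 * (4 * q)))).val • P ∈ Φ₀) := by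
  have hqpr : q.Prime := hq.out
  haveI : NeZero q := ⟨hqpr.ne_zero⟩
  haveI : NeZero (4 * q) := ⟨mul_ne_zero (by norm_num) hqpr.ne_zero⟩
  haveI : NeZero (q : ℚ) := ⟨by exact_mod_cast hqpr.ne_zero⟩
  have hq2 : q ≠ 2 := by rintro rfl; norm_num at hq4
  have hsq : Squarefree (q : ℤ) := (Nat.prime_iff_prime_int.mp hqpr).squarefree
  have hpos : (0 : ℤ) < q := by exact_mod_cast hqpr.pos
  have hq1 : (q : ℤ) ≠ 1 := by exact_mod_cast hqpr.ne_one
  have h3q : ¬ 3 ∣ q := by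
    intro h
    rcases (Nat.dvd_prime hqpr).mp h with h1 | h1
    · norm_num at h1
    · exact hq3 h1.symm
  have h3q' : ¬ (3 : ℤ) ∣ (q : ℤ) := by
    intro h; exact h3q (by exact_mod_cast h)
  have h3N : ¬ 3 ∣ 4 * q := by
    intro h
    rcases (Nat.Prime.dvd_mul Nat.prime_three).mp h with h | h
    · norm_num at h
    · exact h3q h
  -- the radical `√q = ζ₄ · (Gauss sum of (·/q))`
  obtain ⟨i, hi0, hi2, hi⟩ := Rat.exists_sqrt_neg_one_smul_eq_chi4
  obtain ⟨t, ht0, ht2, ht⟩ := Rat.exists_gaussSum (p := q) hq2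
  have hqchar : ringChar (ZMod q) ≠ 2 := by rwa [ZMod.ringChar_zmod_n]
  have ht2' : t ^ 2 = -(q : AlgebraicClosure ℚ) := by
    rw [ht2, quadraticChar_neg_one hqchar, ZMod.card q, ZMod.χ₄_nat_three_mod_four hq4]
    push_cast
    ring
  have hg2 : (i * t) ^ 2 = (((q : ℤ) : ℚ) : AlgebraicClosure ℚ) := by
    rw [mul_pow, hi2, ht2']
    push_cast
    ring
  have hg0 : i * t ≠ 0 := mul_ne_zero hi0 ht0
  have hgs := Rat.smul_mul_eq_changeLevel_mul (dvd_mul_right 4 q) (dvd_mul_left q 4) ZMod.χ₄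
    (quadraticChar (ZMod q)) hi ht
  have hχ2 : ((DirichletCharacter.changeLevel (dvd_mul_right 4 q) ZMod.χ₄ *
      DirichletCharacter.changeLevel (dvd_mul_left q 4) (quadraticChar (ZMod q)) : MulChar (ZMod (4 * q)) ℤ)).IsQuadratic :=
    MulChar.IsQuadratic.mul_int (MulChar.IsQuadratic.changeLevel_int ZMod.isQuadratic_χ₄ _)
      (MulChar.IsQuadratic.changeLevel_int (quadraticChar_isQuadratic (ZMod q)) _)
  exact exists_lineDatum_three_characters_of_cert_quadratic _ hχ2
    (legendreChi4Character_three_isPrimitive hq2) h3N hg0 hg2 hgs hψ hsq hs hDs hpos hq1 h3q'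

end Summit.BirchSwinnertonDyer.Rank1Residual.Additive

end
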